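import Literature.NumberTheory.LFunctions.RayClassLFunctionLandauZeta
import HarnessLib

/-!
# The exceptional zero of a Hecke `L`-function of a ray class character is simple, uniformly in the field and the
# modulus (Thorner–Zaman 2019 Theorem 3.1, multiplicity clause)

Topic `Literature/NumberTheory/LFunctions`, namespace `Literature.NumberTheory.LFunctions`.
Everything here is PROVED (theorems only; no named facts).

The ray-class counterpart of `ClassGroupLFunctionExceptionalZeroSimple.lean`.  For a ray class character `ψ mod 𝔪` non-principal
on the primes `∤ 𝔪`, with primitive data `D` (`χ₀ mod 𝔣`, entire `L(s, χ₀)`):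
* `re_LSeries_primitive_ofReal_le_of_doubleZero` — for `1 < σ ≤ 2` and a point `β ∈ [1/16, 1)` with `ord_β L ≥ 2`,
  `Re L(Λ_{χ₀}, σ) ≤ −2/(σ − β) + 77760 ℳ(0)` (local partial fraction of `L'/L` at height `0`, all other zeros dropped);
* `exists_realZero_simple_rayClass (n)` — for every `n` there is `c = c(n) > 0` such that for `n_K ≤ n`, every such `ψ`, `D`
  and every real zero `β` of `L(·, χ₀)` of order `≥ 2`: `β ≤ 1 − c/(log(|d_K|N𝔪) + log 4)` (MV Theorem 11.3, Case 4 with the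
  zero counted twice: `0 ≤ L(Λ_K,σ) + Re L(Λ_{χ₀},σ)` at `σ = 1 + 2(1 − β)`).

## References
* [ThornerZaman2019] J. Thorner, A. Zaman, Algebra & Number Theory 13 (2019), Theorem 3.1.
* [MontgomeryVaughan2007] H. L. Montgomery, R. C. Vaughan, *Multiplicative Number Theory I*, Theorem 11.3.
-/

noncomputable section

open scoped NumberField nonZeroDivisors
open Complex Filter Topology Set Metric NumberField IsDedekindDomain Finset

namespace Literature.NumberTheory.LFunctions

open Literature.NumberTheory.LFunctions.NumberField Literature.NumberTheory.LFunctions.LogFreeLocal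
open scoped Classical

variable {K : Type*} [Field K] [NumberField K] {𝔪 : Ideal (𝓞 K)} {ψ : HeightOneSpectrum (𝓞 K) → ℂ}

namespace RayClassPrimitiveData

variable (D : RayClassPrimitiveData 𝔪 ψ)

/-- `L'/L(s, χ₀) = −L(Λ_{χ₀}, s)` for `Re s > 1` (the primitive coefficients `mod 𝔣`). [cite: ThornerZaman2019, Theorem 3.1] -/
theorem logDeriv_L_eq {s : ℂ} (hs : 1 < s.re) :
    logDeriv D.L s = -LSeries (twistVonMangoldt K (rayClassCoeffHom D.𝔣 D.χ₀)) s := by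
  have h := neg_logDeriv_continuation_eq_LSeries D.ne_bot D.norm_le_one (L := D.L) D.L_eq hs
  rw [logDeriv_apply, ← h, neg_neg]

/-- **`Re L(Λ_{χ₀}, σ) ≤ −2/(σ − β) + 77760 ℳ(0)`** for `1 < σ ≤ 2`, `β ∈ [1/16, 1)` with `ord_β L(·,χ₀) ≥ 2`.
[cite: MontgomeryVaughan2007, Theorem 11.3 (proof, Case 4)] -/
theorem re_LSeries_primitive_ofReal_le_of_doubleZero (hnt : ∃ v : HeightOneSpectrum (𝓞 K), ¬ 𝔪 ≤ v.asIdeal ∧ ψ v ≠ 1)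
    {β : ℝ} (hβ0 : 1 / 16 ≤ β) (hβ1 : β < 1) (hord : (2 : ℕ∞) ≤ analyticOrderAt D.L β)
    {σ : ℝ} (hσ : 1 < σ) (hσ2 : σ ≤ 2) :
    (LSeries (twistVonMangoldt K (rayClassCoeffHom D.𝔣 D.χ₀)) σ).re ≤ -(2 / (σ - β)) + 77760 * rayDiscBound K 𝔪 0 := by
  have hdf := D.differentiable
  have hc2 : (2 : ℂ) + ((0 : ℝ) : ℂ) * I = 2 := by simp
  have hfc : D.L (2 + ((0 : ℝ) : ℂ) * I) ≠ 0 := D.L_two_add_ne_zero hnt 0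
  have hs : 1 < ((σ : ℂ)).re := by simpa using hσ
  have hsc : (σ : ℂ) ∈ closedBall ((2 : ℂ) + ((0 : ℝ) : ℂ) * I) (7 / 4) := by
    rw [mem_closedBall, dist_eq_norm, hc2, show (σ : ℂ) - 2 = ((σ - 2 : ℝ) : ℂ) by push_cast; ring,
      Complex.norm_real, Real.norm_eq_abs, abs_le]
    constructor <;> linarith
  have hfs : D.L σ ≠ 0 := D.L_ne_zero_of_one_le_re hnt hs.le
  have hpf := D.norm_logDeriv_sub_sum_le hnt 0 hsc hfs
  set S := ∑ ρ ∈ discZeros D.L 0, (discDivisor D.L 0 ρ : ℂ) / ((σ : ℂ) - ρ) with hS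
  -- every term has non-negative real part
  have hterm_re : ∀ u : ℂ, ((discDivisor D.L 0 u : ℂ) / ((σ : ℂ) - u)).re =
      (discDivisor D.L 0 u : ℝ) * (((σ : ℂ) - u)⁻¹).re := fun u ↦ by
    rw [div_eq_mul_inv, show ((discDivisor D.L 0 u : ℤ) : ℂ) = ((discDivisor D.L 0 u : ℝ) : ℂ) by simp,
      Complex.re_ofReal_mul]
  have hDnn : ∀ u, (0 : ℝ) ≤ discDivisor D.L 0 u := fun u ↦ by exact_mod_cast discDivisor_nonneg hdf 0 u
  have hinv_nn : ∀ u ∈ discZeros D.L 0, 0 ≤ (((σ : ℂ) - u)⁻¹).re := by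
    intro u hu
    have hure : u.re < 1 := D.re_lt_one_of_zero hnt ((mem_discZeros hdf hfc).1 hu).2
    rw [Complex.inv_re]
    exact div_nonneg (by simp; linarith) (Complex.normSq_nonneg _)
  have hterm_nn : ∀ u ∈ discZeros D.L 0, 0 ≤ ((discDivisor D.L 0 u : ℂ) / ((σ : ℂ) - u)).re := fun u hu ↦ by
    rw [hterm_re u]; exact mul_nonneg (hDnn u) (hinv_nn u hu)
  -- the zero `β`, multiplicity `≥ 2`
  have hβB : (β : ℂ) ∈ closedBall ((2 : ℂ) + ((0 : ℝ) : ℂ) * I) (31 / 16) := by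
    rw [hc2, mem_closedBall, dist_eq_norm, show (β : ℂ) - 2 = ((β - 2 : ℝ) : ℂ) by push_cast; ring,
      Complex.norm_real, Real.norm_eq_abs, abs_le]
    constructor <;> linarith
  have htop : analyticOrderAt D.L β ≠ ⊤ := analyticOrderAt_ne_top hdf hfc _
  have hzo : 2 ≤ zeroOrder D.L β := by
    have h := hord
    rw [← Nat.cast_analyticOrderNatAt htop] at h
    exact_mod_cast h
  have hβ0' : D.L β = 0 := by
    have := (zeroOrder_pos_iff hdf hfc (β : ℂ)).1 (by omega)
    exact this
  have hβS : (β : ℂ) ∈ discZeros D.L 0 := (mem_discZeros hdf hfc).2 ⟨hβB, hβ0'⟩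
  have hDβ : (2 : ℝ) ≤ discDivisor D.L 0 β := by
    rw [discDivisor_eq_zeroOrder hdf hfc hβB]; exact_mod_cast hzo
  have eβ : (((σ : ℂ) - β)⁻¹).re = 1 / (σ - β) := by
    rw [show (σ : ℂ) - β = ((σ - β : ℝ) : ℂ) by push_cast; ring, ← Complex.ofReal_inv, Complex.ofReal_re, one_div]
  have hsum_ge : 2 / (σ - β) ≤ S.re := by
    rw [hS, Complex.re_sum]
    have hsingle := Finset.single_le_sum hterm_nn hβS
    rw [hterm_re, eβ] at hsingle
    have hpβ : 0 < 1 / (σ - β) := one_div_pos.mpr (by linarith)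
    have : 2 / (σ - β) ≤ (discDivisor D.L 0 β : ℝ) * (1 / (σ - β)) := by
      rw [show 2 / (σ - β) = 2 * (1 / (σ - β)) by ring]; nlinarith
    exact this.trans hsingle
  -- assemble
  rw [← neg_neg (LSeries _ _), ← D.logDeriv_L_eq hs, Complex.neg_re,
    show logDeriv D.L σ = S + (logDeriv D.L σ - S) by ring, Complex.add_re]
  have h1 := Complex.abs_re_le_norm (logDeriv D.L σ - S)
  have h2 := neg_abs_le (logDeriv D.L σ - S).re
  linarith

end RayClassPrimitiveData

/-- `log 7 < 2`. [cite: MontgomeryVaughan2007, Theorem 11.3] -/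
private theorem log_seven_lt_two : Real.log 7 < 2 := by
  rw [Real.log_lt_iff_lt_exp (by norm_num)]
  have h := Real.exp_one_gt_d9
  have : Real.exp 2 = Real.exp 1 ^ 2 := by rw [← Real.exp_nat_mul]; norm_num
  rw [this]; nlinarith

/-- `ℳ(0) ≤ (5n_K + 2)(log(|d_K|N𝔪) + log 4)`. [cite: ThornerZaman2019, Theorem 3.1] -/
theorem rayDiscBound_zero_le (h𝔪 : 𝔪 ≠ ⊥) :
    rayDiscBound K 𝔪 0 ≤ (5 * Module.finrank ℚ K + 2) *
      (Real.log (((discr K).natAbs : ℝ) * ((Ideal.absNorm 𝔪 : ℕ) : ℝ)) + Real.log 4) := by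
  rw [rayDiscBound, abs_zero, zero_add]
  have hQ1 := one_le_discr_mul_absNorm K h𝔪
  have hL : 1 ≤ Real.log (((discr K).natAbs : ℝ) * ((Ideal.absNorm 𝔪 : ℕ) : ℝ)) + Real.log 4 :=
    UniformTwistedZFRData.log_add_log_four_ge hQ1
  have hlogQ : 0 ≤ Real.log (((discr K).natAbs : ℝ) * ((Ideal.absNorm 𝔪 : ℕ) : ℝ)) := Real.log_nonneg hQ1
  have h7 := log_seven_lt_two
  have hn : (0 : ℝ) ≤ Module.finrank ℚ K := Nat.cast_nonneg _
  have hlog4 : 0 < Real.log (4 : ℝ) := Real.log_pos (by norm_num)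
  nlinarith

/-- **The exceptional zero is simple, uniformly in the field and the modulus** ([ThornerZaman2019, Theorem 3.1],
multiplicity clause; MV Theorem 11.3): for every `n` there is `c = c(n) > 0` such that for every `K` with `n_K ≤ n`, every
`𝔪 ≠ 0`, every ray class character `ψ mod 𝔪` non-principal on the primes `∤ 𝔪` with primitive data `D`, and every real zero
`β` of `L(·, χ₀)` of order at least `2`: `β ≤ 1 − c/(log(|d_K|N𝔪) + log 4)`. [cite: MontgomeryVaughan2007, Theorem 11.3] -/
theorem exists_realZero_simple_rayClass (n : ℕ) :
    ∃ c : ℝ, 0 < c ∧ ∀ (K : Type*) [Field K] [NumberField K], Module.finrank ℚ K ≤ n →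
      ∀ (𝔪 : Ideal (𝓞 K)) (ψ : HeightOneSpectrum (𝓞 K) → ℂ),
      (∃ v : HeightOneSpectrum (𝓞 K), ¬ 𝔪 ≤ v.asIdeal ∧ ψ v ≠ 1) →
      ∀ (D : RayClassPrimitiveData 𝔪 ψ) (β : ℝ), D.L β = 0 → (2 : ℕ∞) ≤ analyticOrderAt D.L β →
        β ≤ 1 - c / (Real.log (((discr K).natAbs : ℝ) * ((Ideal.absNorm 𝔪 : ℕ) : ℝ)) + Real.log 4) := by
  set Kc : ℝ := 77760 * (5 * n + 2) with hKc
  have hKc0 : 0 ≤ Kc := by positivity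
  set c : ℝ := min (1 / 4) (1 / (6 * (2 * Kc + 1))) with hcdef
  have hc : 0 < c := lt_min (by norm_num) (by positivity)
  have hc4 : c ≤ 1 / 4 := min_le_left _ _
  have hcK : c ≤ 1 / (6 * (2 * Kc + 1)) := min_le_right _ _
  refine ⟨c, hc, fun K _ _ hnK 𝔪 ψ hnt D β hzero hord ↦ ?_⟩
  have h𝔪 := D.modulus_ne_bot
  set ℒ₀ : ℝ := Real.log (((discr K).natAbs : ℝ) * ((Ideal.absNorm 𝔪 : ℕ) : ℝ)) + Real.log 4 with hℒ₀
  have hQ1 := one_le_discr_mul_absNorm K h𝔪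
  have hℒ₀1 : 1 ≤ ℒ₀ := UniformTwistedZFRData.log_add_log_four_ge hQ1
  have hℒ₀0 : 0 < ℒ₀ := by linarith
  have hcℒ : c / ℒ₀ ≤ c := div_le_self hc.le hℒ₀1
  have hz' : D.LMod β = 0 := by rw [RayClassPrimitiveData.LMod, hzero, zero_mul]
  have hβ1 : β < 1 := D.realZero_lt_one hnt hz'
  set u : ℝ := 1 - β with hu
  have hu0 : 0 < u := by rw [hu]; linarith
  by_contra hcon
  rw [not_le] at hcon
  have hularge : u < c / ℒ₀ := by rw [hu]; linarith
  have husmall : u < 1 / 4 := by linarith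
  have hβ0 : 1 / 16 ≤ β := by linarith
  set σ : ℝ := 1 + 2 * u with hσdef
  have hσ1 : 1 < σ := by rw [hσdef]; linarith
  have hσ2 : σ ≤ 2 := by rw [hσdef]; linarith
  have hB := D.re_LSeries_primitive_ofReal_le_of_doubleZero hnt hβ0 hβ1 hord hσ1 hσ2
  have hA := re_LSeries_vonMangoldtNorm_ofReal_le (K := K) hσ1 hσ2
  have h114 := TwistedZFR.re_add_re_nonneg (norm_twistVonMangoldt_le (norm_rayClassCoeffHom_le D.ne_bot D.norm_le_one))
    (fun s hs ↦ LSeriesSummable_vonMangoldtNorm hs) hσ1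
  -- the constants against `ℒ₀`
  have hnK' : (Module.finrank ℚ K : ℝ) ≤ n := by exact_mod_cast hnK
  have hd : (0 : ℝ) < ((discr K).natAbs : ℝ) := by exact_mod_cast Int.natAbs_pos.mpr (discr_ne_zero K)
  have hm1 : (1 : ℝ) ≤ ((Ideal.absNorm 𝔪 : ℕ) : ℝ) := by
    exact_mod_cast Nat.one_le_iff_ne_zero.mpr (by rw [Ne, Ideal.absNorm_eq_zero_iff]; exact h𝔪)
  have hlogd : Real.log ((discr K).natAbs : ℝ) + Real.log 4 ≤ ℒ₀ := by
    have := Real.log_le_log hd (show ((discr K).natAbs : ℝ) ≤ ((discr K).natAbs : ℝ) * ((Ideal.absNorm 𝔪 : ℕ) : ℝ) by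
      nlinarith)
    rw [hℒ₀]; linarith
  have hlogd0 : 0 ≤ Real.log ((discr K).natAbs : ℝ) + Real.log 4 := by
    have := Real.log_nonneg (show (1 : ℝ) ≤ ((discr K).natAbs : ℝ) by exact_mod_cast Int.natAbs_pos.mpr (discr_ne_zero K))
    have : 0 < Real.log (4 : ℝ) := Real.log_pos (by norm_num); linarith
  have hM1 : 77760 * (5 * (Module.finrank ℚ K : ℝ) + 2) * (Real.log ((discr K).natAbs : ℝ) + Real.log 4) ≤ Kc * ℒ₀ := by
    rw [hKc]
    calc 77760 * (5 * (Module.finrank ℚ K : ℝ) + 2) * (Real.log ((discr K).natAbs : ℝ) + Real.log 4)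
        ≤ 77760 * (5 * (n : ℝ) + 2) * (Real.log ((discr K).natAbs : ℝ) + Real.log 4) := by gcongr
      _ ≤ 77760 * (5 * (n : ℝ) + 2) * ℒ₀ := by gcongr
  have hM2 : 77760 * rayDiscBound K 𝔪 0 ≤ Kc * ℒ₀ := by
    have h := rayDiscBound_zero_le (K := K) h𝔪
    rw [hKc]
    calc 77760 * rayDiscBound K 𝔪 0 ≤ 77760 * ((5 * Module.finrank ℚ K + 2) * ℒ₀) := by rw [hℒ₀]; gcongr
      _ ≤ 77760 * ((5 * (n : ℝ) + 2) * ℒ₀) := by gcongr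
      _ = 77760 * (5 * (n : ℝ) + 2) * ℒ₀ := by ring
  -- combine: `2/(σ−β) − 1/(σ−1) ≤ 2 Kc ℒ₀`
  have hkey : 2 / (σ - β) - 1 / (σ - 1) ≤ 2 * Kc * ℒ₀ := by
    linarith
  have hval : 2 / (σ - β) - 1 / (σ - 1) = 1 / (6 * u) := by
    have e1 : σ - β = 3 * u := by rw [hσdef, hu]; ring
    have e2 : σ - 1 = 2 * u := by rw [hσdef]; ring
    have hu' : u ≠ 0 := hu0.ne'
    rw [e1, e2]
    field_simp
    norm_num
  rw [hval] at hkey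
  have hKE : 0 < 6 * (2 * Kc + 1) := by positivity
  have hc' : c * (6 * (2 * Kc + 1)) ≤ 1 := by rw [le_div_iff₀ hKE] at hcK; exact hcK
  have h6 : 1 ≤ 6 * u * (2 * Kc * ℒ₀) := by
    rw [div_le_iff₀ (by positivity)] at hkey; linarith
  have h7 : 6 * u * (2 * Kc * ℒ₀) ≤ (u * ℒ₀) * (6 * (2 * Kc + 1)) := by
    have : 2 * Kc * ℒ₀ ≤ (2 * Kc + 1) * ℒ₀ := mul_le_mul_of_nonneg_right (by linarith) hℒ₀0.le
    calc 6 * u * (2 * Kc * ℒ₀) ≤ 6 * u * ((2 * Kc + 1) * ℒ₀) := mul_le_mul_of_nonneg_left this (by positivity)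
      _ = (u * ℒ₀) * (6 * (2 * Kc + 1)) := by ring
  have hfinal : c / ℒ₀ ≤ u := by
    rw [div_le_iff₀ hℒ₀0]
    exact le_of_mul_le_mul_right (hc'.trans (h6.trans h7)) hKE
  linarith

end Literature.NumberTheory.LFunctions

end
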